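import Literature.AnabelianGeometry.EtaleTheta.XuuCocycleOfInvariance
import Literature.AnabelianGeometry.EtaleTheta.ThetaKummerDeck
import Literature.AnabelianGeometry.EtaleTheta.ThetaKummerTranslates
import HarnessLib

/-!
# [EtTh] Prop. 2.2 (ii) / Def. 2.7 in the §1 model: the choice `X̲̲` from the Kummer-function
# presentation of `η̈^Θ` and the functional equations of Prop. 1.4 (ii)

Mochizuki, *The étale theta function and its Frobenioid-theoretic manifestations*, Publ. RIMS **45**
(2009): Prop. 1.4 (ii) (PRIMS PDF p. 22) "`Θ̈(−Ü) = −Θ̈(Ü)`; `Θ̈(q_X^{a/2} Ü) = (−1)^a q_X^{−a²/2} Ü^{−2a} Θ̈(Ü)`";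
Def. 2.7 (p. 41) "`Π^tp_X̲/Π^tp_Ÿ ≅ (l·Z) × μ₂`", "a choice of `η̈^Θ` up to an `(O_K^×)^l`-multiple"
[cite: MochizukiEtTh2009, Def 2.7 p.41].

Cell abc-iut, layer L2, item N3 (seat abc-iut-L2-t7). PROOF-ONLY companion of
`XuuCocycleOfInvariance.lean`, which constructs the choice `X̲̲` (seat abc-iut-L2-t8's `DoubleUnderline`)
from the hypothesis "`η̈^Θ` is invariant modulo `l`-th powers under `Π^tp_X̲`", reduced there
(`invariant_modPow_of_generators`) to ONE lift `t₁` of the generator of `Gal(Ÿ/Y) ≅ μ₂` and ONE lift `t`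
of `l ∈ Z`. Here both generator statements are DERIVED from the Kummer-function presentation of
`η̈^Θ` (seat abc-iut-L2-t12's `ThetaKummerInput T`: the function `Θ̈ ∈ Fn`, `η̈^Θ = κ(Θ̈)` — route
R-8/R-9 of `ThetaKummerClass.lean`) and the functional equations of Prop. 1.4 (ii) read on `Fn`, in the
hypothesis style of `ThetaKummerDeck.lean` / `ThetaKummerTranslates.lean` (seat abc-iut-w5-d125; `Fn` has
no carrier, so function-level identities are hypotheses on the data):

* `μ₂`: `hdeck` — every `ε ∈ Π^tp_Y ∖ Π^tp_Ÿ` pulls `Θ̈` back to `(−1)·Θ̈`; then `ε·η̈^Θ = η̈^Θ·κ(−1)` with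
  `κ(−1)² = 1` (`ThetaKummerDeck`), an `l`-th power for `l` odd;
* `l·Z`: `htrans` — the lift `t` of `l ∈ Z` pulls `Θ̈` back to `g^l · Θ̈` for a function `g` on `Ÿ` with
  compatible roots. This IS the third equation of Prop. 1.4 (ii) at `a = l`:
  `(−1)^l q̈^{−l²} Ü^{−2l} = (−q̈^{−l} · Ü^{−2})^l`, i.e. `g = const(−q̈^{−l}) · Ü^{∓2}`; then
  `t·κ(Θ̈) = κ(g)^l · κ(Θ̈)` by the equivariance and multiplicativity of continuous Kummer classes
  (`KummerContH1Conj.lean`, `kummerContClass_mul`).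

Results: `ThetaKummerInput.conj_kummerTheta_of_smul_eq_pow_mul`, the two stabilizer memberships, the
hypothesis `hinv` of `XuuCocycleOfInvariance.lean` (`invariant_modPow_of_kummer`), and
**`nonempty_doubleUnderline_of_kummer`**: the choice `X̲̲` exists in the §1 model given {`Compat`,
`Sec2Hyps`, `Prop15iii`, `CyclotomeMod 1 l`, `l` odd, `η̈^Θ = κ(Θ̈)`, `hdeck`, `htrans`}. No definitions;
no statement of [EtTh] is asserted; Prop. 1.4 is classical; typed ≠ endorsed; no side is taken on any
disputed claim.
-/

noncomputable section

namespace Literature.AnabelianGeometry.EtaleTheta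

open Literature.AnabelianGeometry.SemiGraphs

namespace ThetaSetting

variable {p : ℕ} [Fact p.Prime] {D : ThetaSetting p}

/-! ### A lift of `l ∈ Z` in terms of `toZ` -/

/-- An element `t ∈ Π^tp_X` with `toZ(t) = l` lies in `Π^tp_X̲ = toZ⁻¹(l·Z)`. [cite: MochizukiEtTh2009, Def 2.7 p.41] -/
theorem mem_GtpXu_of_toZ_eq {l : ℕ} {t : D.PiTemp} (htZ : D.toZ t = Multiplicative.ofAdd (l : ℤ)) :
    t ∈ D.GtpXu l := by
  change D.toZ t ∈ lZ l
  rw [htZ]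
  exact Subgroup.mem_zpowers _

/-- … and is a lift of the generator: `toZ(t)/l = 1`. [cite: MochizukiEtTh2009, Def 2.7 p.41] -/
theorem toZDivL_eq_of_toZ_eq {l : ℕ} (hl : l ≠ 0) {t : D.PiTemp}
    (htZ : D.toZ t = Multiplicative.ofAdd (l : ℤ)) :
    D.toZDivL l hl ⟨t, mem_GtpXu_of_toZ_eq htZ⟩ = Multiplicative.ofAdd 1 := by
  have hl' : (l : ℤ) ≠ 0 := by exact_mod_cast hl
  change Multiplicative.ofAdd (D.zExpXu l ⟨t, mem_GtpXu_of_toZ_eq htZ⟩) = _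
  congr 1
  apply mul_left_cancel₀ hl'
  rw [← D.toZ_eq_mul_zExpXu l hl, mul_one]
  change Multiplicative.toAdd (D.toZ t) = _
  rw [htZ]
  rfl

namespace ThetaKummerInput

variable (T : D.ThetaKummerInput)

/-- `g^n · Θ̈` is fixed by `Π^tp_Ÿ` when `g` is. [cite: MochizukiEtTh2009, Prop 1.4 (ii) p.22] -/
theorem pow_mul_theta_mem {g : T.Fn} (hg : g ∈ MulAction.fixedPoints D.GtpYdd T.Fn) (n : ℕ) :
    g ^ n * T.theta ∈ MulAction.fixedPoints D.GtpYdd T.Fn := fun h => by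
  change (h : D.PiTemp) • (g ^ n * T.theta) = g ^ n * T.theta
  rw [smul_mul', smul_pow', show (h : D.PiTemp) • g = g from hg h,
    show (h : D.PiTemp) • T.theta = T.theta from T.theta_mem h]

/-- **A pull-back identity `t•Θ̈ = g^n · Θ̈` at the level of Kummer classes**: if `t ∈ Π^tp_X` pulls
`Θ̈` back to `g^n · Θ̈` for a `Π^tp_Ÿ`-invariant function `g` with compatible roots `x`, then
`t·κ(Θ̈) = κ(g)^n · κ(Θ̈)` in `H¹(Π^tp_Ÿ, Δ_Θ)` (equivariance of the continuous Kummer class, Kummer class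
of a product, Kummer class of a power). For `t` a lift of `a ∈ Z` this is Prop. 1.4 (ii)'s
`Θ̈(q_X^{a/2}Ü) = (−1)^a q_X^{−a²/2} Ü^{−2a} Θ̈(Ü)` read in cohomology. [cite: MochizukiEtTh2009, Prop 1.4 (ii) p.22] -/
theorem conj_kummerTheta_of_smul_eq_pow_mul [D.GtpYdd.Normal] {g : T.Fn}
    (hg : g ∈ MulAction.fixedPoints D.GtpYdd T.Fn) (x : RootSystem g) (n : ℕ) {t : D.PiTemp}
    (ht : t • T.theta = g ^ n * T.theta) :
    ContH1.conj D.toTheta D.DeltaTheta t T.kummerTheta =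
      T.coeff.kummerContClass D.GtpYdd x hg (fun _ => T.isOpen_stabilizer _) ^ n * T.kummerTheta := by
  obtain ⟨y, hy⟩ := T.coeff.exists_rootSystem_pow_kummerContClass_eq D.GtpYdd T.isOpen_stabilizer x hg n
  rw [← hy, kummerTheta,
    ← T.coeff.kummerContClass_mul D.GtpYdd y T.thetaRoots
      (CyclotomeCoefficients.pow_mem_fixedPoints D.GtpYdd hg n) T.theta_mem (T.pow_mul_theta_mem hg n)
      (fun _ => T.isOpen_stabilizer _) (fun _ => T.isOpen_stabilizer _) (fun _ => T.isOpen_stabilizer _)]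
  exact T.coeff.conj_kummerContClass_of_smul_eq D.GtpYdd t T.thetaRoots (y.mul T.thetaRoots) T.theta_mem
    (T.pow_mul_theta_mem hg n) (fun _ => T.isOpen_stabilizer _) (fun _ => T.isOpen_stabilizer _)
    (fun _ => T.isOpen_stabilizer _) ht

end ThetaKummerInput

namespace EtaleThetaData

variable (T : D.ThetaKummerInput) {E : D.EtaleThetaData}

/-- **The `l·Z`-generator from Prop. 1.4 (ii)**: if `η̈^Θ = κ(Θ̈)` and `t` pulls `Θ̈` back to `g^n · Θ̈`
(`g` on `Ÿ` with compatible roots), then `t` stabilizes `η̈^Θ` modulo `n`-th powers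
(`t·η̈^Θ = η̈^Θ · κ(g)^n`). [cite: MochizukiEtTh2009, Prop 1.4 (ii) p.22] -/
theorem mem_invModPowStabilizer_of_kummer_translate [D.GtpYdd.Normal] (hη : E.etaDd = T.kummerTheta)
    {g : T.Fn} (hg : g ∈ MulAction.fixedPoints D.GtpYdd T.Fn) (x : RootSystem g) (n : ℕ)
    {t : D.PiTemp} (ht : t • T.theta = g ^ n * T.theta) :
    t ∈ invModPowStabilizer E.etaDd n :=
  ⟨T.coeff.kummerContClass D.GtpYdd x hg (fun _ => T.isOpen_stabilizer _), by
    rw [hη, T.conj_kummerTheta_of_smul_eq_pow_mul hg x n ht, mul_comm]⟩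

/-- **The `μ₂`-generator from Prop. 1.4 (ii)** (`Θ̈(−Ü) = −Θ̈(Ü)`, hypothesis `hdeck` of
`ThetaKummerDeck.lean`): if `η̈^Θ = κ(Θ̈)`, every `ε ∈ Π^tp_Y ∖ Π^tp_Ÿ` stabilizes `η̈^Θ` modulo `n`-th powers
for `n` ODD (`ε·η̈^Θ = η̈^Θ·κ(−1)`, `κ(−1)² = 1`, so `κ(−1) = κ(−1)^n`). [cite: MochizukiEtTh2009, Prop 1.4 (ii) p.22] -/
theorem mem_invModPowStabilizer_of_kummer_deck [D.GtpYdd.Normal] (hη : E.etaDd = T.kummerTheta)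
    (hdeck : ∀ ε : D.PiTemp, ε ∈ D.GtpY → ε ∉ D.GtpYdd → ε • T.theta = T.const (-1) * T.theta)
    {n : ℕ} (hn : Odd n) {ε : D.PiTemp} (hε₁ : ε ∈ D.GtpY) (hε₂ : ε ∉ D.GtpYdd) :
    ε ∈ invModPowStabilizer E.etaDd n := by
  obtain ⟨κ, hκ, h⟩ := exists_sq_one_conj_etaDd_of_deck T E hdeck hη hε₁ hε₂
  exact mem_invModPowStabilizer_of_sq_eq_one E.etaDd hn hκ h

/-- **Invariance of `η̈^Θ` modulo `l`-th powers under `Π^tp_X̲`, from the Kummer-function inputs**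
(`η̈^Θ = κ(Θ̈)`; Prop. 1.4 (ii) as `hdeck` and as the pull-back identity `t•Θ̈ = g^l·Θ̈` for ONE lift `t` of
`l ∈ Z` — in print `g = −q̈^{−l}·Ü^{∓2}`, since `(−1)^l q̈^{−l²} Ü^{∓2l} = (−q̈^{−l} Ü^{∓2})^l`):
the hypothesis `hinv` of `XuuCocycleOfInvariance.lean`. [cite: MochizukiEtTh2009, Def 2.7 p.41] -/
theorem invariant_modPow_of_kummer (hS : D.Sec2Hyps) [D.GtpYdd.Normal] (hη : E.etaDd = T.kummerTheta)
    (hdeck : ∀ ε : D.PiTemp, ε ∈ D.GtpY → ε ∉ D.GtpYdd → ε • T.theta = T.const (-1) * T.theta)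
    {l : ℕ} (hl : Odd l) {g : T.Fn} (hg : g ∈ MulAction.fixedPoints D.GtpYdd T.Fn) (x : RootSystem g)
    {t : D.PiTemp} (ht : t ∈ D.GtpXu l) (hχt : D.toZDivL l hl.pos.ne' ⟨t, ht⟩ = Multiplicative.ofAdd 1)
    (htrans : t • T.theta = g ^ l * T.theta) :
    ∀ σ ∈ D.GtpXu l, ∃ κ : D.H1 D.GtpYdd,
      ContH1.conj D.toTheta D.DeltaTheta σ E.etaDd = E.etaDd * κ ^ l := by
  obtain ⟨t₁, ht₁, ht₁N⟩ := D.exists_mem_GtpY_not_mem_GtpYdd hS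
  exact invariant_modPow_of_generators hS E.etaDd l hl.pos.ne' ht₁ ht₁N
    (mem_invModPowStabilizer_of_kummer_deck T hη hdeck hl ht₁ ht₁N) ht hχt
    (mem_invModPowStabilizer_of_kummer_translate T hη hg x l htrans)

/-- **The choice `X̲̲` exists in the §1 model from the Kummer-function inputs**: given `Compat`,
`K = K̈` (`Sec2Hyps`), Prop. 1.5 (iii) (`Prop15iii`, for the normalisation over `Δ_Θ`), the cyclotome
identification `Δ_Θ/l ≅ μ_l` (`CyclotomeMod 1 l`), `l` odd, the presentation `η̈^Θ = κ(Θ̈)` and the two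
Prop. 1.4 (ii) inputs `hdeck`, `htrans`, seat abc-iut-L2-t8's `DoubleUnderline l` is inhabited (all its
printed properties PROVED, `XuuCocycleOfInvariance.doubleUnderlineOfInvariance`).
[cite: MochizukiEtTh2009, Def 2.7 p.41] -/
theorem nonempty_doubleUnderline_of_kummer (hC : D.Compat) (hS : D.Sec2Hyps) [D.GtpYdd.Normal]
    (h15 : Prop15iii E hC) {l : ℕ+} (μ : D.CyclotomeMod 1 l) (hl : Odd (l : ℕ))
    (hη : E.etaDd = T.kummerTheta)
    (hdeck : ∀ ε : D.PiTemp, ε ∈ D.GtpY → ε ∉ D.GtpYdd → ε • T.theta = T.const (-1) * T.theta)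
    {g : T.Fn} (hg : g ∈ MulAction.fixedPoints D.GtpYdd T.Fn) (x : RootSystem g)
    {t : D.PiTemp} (ht : t ∈ D.GtpXu l) (hχt : D.toZDivL l hl.pos.ne' ⟨t, ht⟩ = Multiplicative.ofAdd 1)
    (htrans : t • T.theta = g ^ (l : ℕ) * T.theta) :
    Nonempty (E.DoubleUnderline l) :=
  nonempty_doubleUnderline_of_invariance hC hS h15 μ hl
    (invariant_modPow_of_kummer T hS hη hdeck hl hg x ht hχt htrans)

/-- The same with the lift of `l ∈ Z` given as any `t ∈ Π^tp_X` with `toZ(t) = l` (the shape in which a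
consumer meets it: `t` = the `l`-th power of a lift of the generator of `Z = Gal(Y/X)`; Prop. 1.4 (ii) at
`a = l` then reads `t•Θ̈ = g^l·Θ̈` with `g = −q̈^{−l}·Ü^{∓2}`). [cite: MochizukiEtTh2009, Def 2.7 p.41] -/
theorem invariant_modPow_of_kummer_of_toZ_eq (hS : D.Sec2Hyps) [D.GtpYdd.Normal]
    (hη : E.etaDd = T.kummerTheta)
    (hdeck : ∀ ε : D.PiTemp, ε ∈ D.GtpY → ε ∉ D.GtpYdd → ε • T.theta = T.const (-1) * T.theta)
    {l : ℕ} (hl : Odd l) {g : T.Fn} (hg : g ∈ MulAction.fixedPoints D.GtpYdd T.Fn) (x : RootSystem g)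
    {t : D.PiTemp} (htZ : D.toZ t = Multiplicative.ofAdd (l : ℤ)) (htrans : t • T.theta = g ^ l * T.theta) :
    ∀ σ ∈ D.GtpXu l, ∃ κ : D.H1 D.GtpYdd,
      ContH1.conj D.toTheta D.DeltaTheta σ E.etaDd = E.etaDd * κ ^ l :=
  invariant_modPow_of_kummer T hS hη hdeck hl hg x (mem_GtpXu_of_toZ_eq htZ)
    (toZDivL_eq_of_toZ_eq hl.pos.ne' htZ) htrans

/-- **The choice `X̲̲` exists in the §1 model from the Kummer-function inputs**, `toZ`-form of the lift
(see `nonempty_doubleUnderline_of_kummer`). [cite: MochizukiEtTh2009, Def 2.7 p.41] -/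
theorem nonempty_doubleUnderline_of_kummer_of_toZ_eq (hC : D.Compat) (hS : D.Sec2Hyps)
    [D.GtpYdd.Normal] (h15 : Prop15iii E hC) {l : ℕ+} (μ : D.CyclotomeMod 1 l) (hl : Odd (l : ℕ))
    (hη : E.etaDd = T.kummerTheta)
    (hdeck : ∀ ε : D.PiTemp, ε ∈ D.GtpY → ε ∉ D.GtpYdd → ε • T.theta = T.const (-1) * T.theta)
    {g : T.Fn} (hg : g ∈ MulAction.fixedPoints D.GtpYdd T.Fn) (x : RootSystem g)
    {t : D.PiTemp} (htZ : D.toZ t = Multiplicative.ofAdd ((l : ℕ) : ℤ))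
    (htrans : t • T.theta = g ^ (l : ℕ) * T.theta) :
    Nonempty (E.DoubleUnderline l) :=
  nonempty_doubleUnderline_of_invariance hC hS h15 μ hl
    (invariant_modPow_of_kummer_of_toZ_eq T hS hη hdeck hl hg x htZ htrans)

end EtaleThetaData

end ThetaSetting

end Literature.AnabelianGeometry.EtaleTheta

end
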